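import Mathlib
import HarnessLib
import Summits.Parity.BatemanHorn.Theses.AlmostPrimeZeros
import Summits.Parity.BatemanHorn.Theorems.AlmostPrimeZerosSystemMomentDeficitOfDiscMajorantLog
import Summits.Parity.BatemanHorn.Theorems.AlmostPrimeZerosSystemMomentDeficitVerticalLine

/-!
# Crux `SystemMomentDeficit` (stmt-Parity-11326) — line `Sketch` (idea `small-circle-jensen`)

Route `AlmostPrimeZeros`, crux
`Summit.Parity.BatemanHorn.Theses.AlmostPrimeZeros.SystemMomentDeficit` (rank 4): for every
Bateman–Horn system `f`, the factorial-moment deficit `m₁(x) − v(x)` of the capped statistic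
`s_f(n) = Σ_i Σ_{p^v ∥ f_i(n)} min(v, 2)` is bounded above for `x ≥ 2`.

## The line (lead a1's skeleton, reshaped by lead c6)

Let `S_x(z) = Σ_{0 ≤ n ≤ x} z^{s_f(n)}` (`S_x(1) = x + 1 =: N`).  The deficit is a second-order
datum of `S_x` at the free centre `z = 1`; the line bounds it from an analytic majorant near `1`.

* Lead a1 registered K1 = `stub_smallCircleJensen` (angular mean of `log⁺‖S_x(z)e^{−a(z−1)}/N‖`
  on one circle `‖z−1‖ = r` bounded, uniformly in `x`) and landed the transfer K1 ⇒ crux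
  (`systemMomentDeficit_of_smallCircle`, Jensen ⇒ zero-free disc, Poisson–Jensen, Borel–Carathéodory,
  Cauchy; `Theorems/AlmostPrimeZerosSystemMomentDeficitOfDiscMajorantLog.lean`, p140704), the edges
  rank 8 ⇒ K1 (p140287), rank 2 ⇒ K1 (p140991) and K1 at `(X)` (p140780).
* Lead c6 (this reshape): the deficit is the CURVATURE OF `‖S_x(1+iy)‖²` IN THE IMAGINARY
  DIRECTION at `y = 0`: `(d²/dy²)‖S_x(1+iy)‖² |_{y=0} = 2N²(m₁ − v)` exactly, and the first
  derivative vanishes (`Theorems/AlmostPrimeZerosSystemMomentDeficitVerticalLine.lean`, p163855).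
  On the vertical line every real tilt `e^{−a(z−1)}` has modulus `1`, so NO tilt, NO Jensen formula
  and NO Borel–Carathéodory are needed: a PINCHED sub-Gaussian bound `‖S_x(1+iy)‖ ≤ N e^{C y²}` for
  `0 < y ≤ y₀` gives `m₁ − v ≤ 2C` by a second-derivative comparison at the touching point `y = 0`
  (`deficit_le_of_verticalBound`; edge `systemMomentDeficit_of_verticalSubGaussian`, registered
  sub-goal, landed).  The registered stub of the line is therefore weakened from K1 to
  **VSG = `stub_verticalSubGaussian`** below; K1 implies it (Poisson–Jensen + Borel–Carathéodory give
  `|log H| = O(A)` on a smaller disc and `Re[(log H)'(1)·iy] = 0` because `(log H)'(1) = m₁ − a` is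
  real), so rank 8 and rank 2 still feed the line through K1.
* Why VSG and not K1: it is the weakest hypothesis of majorant type that the line's transfer can
  use — one segment transversal to the real axis, upper bounds only, one-sided conclusion (it holds
  with room for the reducible non-systems `(X²)`, `(X,X)` where `|m₁ − v| ≤ C` fails, Disproof §8–9,
  while K1 forces the two-sided bound).  Probabilistically: `‖S_x(1+iy)‖/N = |E_x (1+iy)^{s_f}|`, and
  VSG is Gaussian decay of the (size-tilted) characteristic function of `s_f` at FIXED small
  frequency to the full depth `e^{−Var·y²/2 + O(y²)}`, uniformly in `x` (in the Poisson model
  `E z^s = e^{λ(z−1)}` it holds with `C = 0` for all `y`).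
* Status of VSG: OPEN for every system with `Σ deg f_i ≥ 2`, for the same reason as K1 — by anatomy
  classes `S_x(1+iy) = Σ_b (1+iy)^b T_b(1+iy)` (`b` = number of prime factors beyond the sieve level),
  and the bound needs Poisson-rate cancellation of `Σ (1+iy)^{s_rest(n)}` on rough and smooth values
  separately: the universality input (U) of `Cruxes/SystemMomentDeficit/NOTES.md` at
  characteristic-function level, restricted to `Re z = 1`.  Known: `k = 0`; `k = 1`, `f = X` (via K1 at
  `(X)`).  For all-linear systems the CRUX is a theorem (p106798) while VSG/K1 are open for `k ≥ 2`.

References: idea card `Cruxes/SystemMomentDeficit/Ideas/small-circle-jensen.md`; crux notes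
`Cruxes/SystemMomentDeficit/NOTES.md`; G. Tenenbaum, *Introduction to analytic and probabilistic
number theory*, II.5–II.6, III.4.
-/

noncomputable section

namespace Summit.Parity.BatemanHorn.Cruxes.SystemMomentDeficit.SmallCircle

open scoped BigOperators Nat
open Polynomial
open Summit.Parity.BatemanHorn.Theses.AlmostPrimeZeros

/-! ### Registered stub -/

/-- **VSG (`VerticalSubGaussian`, the crux's analytic core on the line; lead).**  For every
Bateman–Horn system `f` there are `C`, `y₀ > 0` and `x₀` such that
`‖Σ_{n ≤ x} (1 + iy)^{s_f(n)}‖ ≤ (x + 1)·e^{C y²}` for all `x ≥ x₀` and `0 < y ≤ y₀`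
(a pinched sub-Gaussian bound for the almost-prime polynomial on a vertical segment through `z = 1`;
by conjugation the same then holds for `−y₀ ≤ y < 0`).  Implied by K1 `stub_smallCircleJensen`, hence
by `DiscMajorantLog` (rank 8) and `SystemZeroRepulsion` (rank 2); open for every system with
`Σ deg f_i ≥ 2`. -/
theorem stub_verticalSubGaussian :
    ∀ (k : ℕ) (f : Fin k → Polynomial ℤ), Literature.NumberTheory.Sieve.IsBatemanHornSystem f →
      ∃ C y₀ : ℝ, ∃ x₀ : ℕ, 0 < y₀ ∧ ∀ x : ℕ, x₀ ≤ x → ∀ y : ℝ, 0 < y → y ≤ y₀ →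
        ‖∑ n ∈ Finset.range (x + 1), (1 + (y : ℂ) * Complex.I) ^
            (∑ i, (((f i).eval (n : ℤ)).toNat.factorization.sum fun _ v => min v 2))‖ ≤
          ((x : ℝ) + 1) * Real.exp (C * y ^ 2) := by
  sorry

/-! ### Landed (same namespace): `systemMomentDeficit_of_verticalSubGaussian` (edge VSG ⇒ crux by name,
`…VerticalLine.lean`, p163855); K1 apparatus `stub_zeroFree` (p140102), `stub_poissonJensenBound` (p140189),
`stub_logDerivBound` (p140086), `stub_logDerivPolynomial` (p140125), `systemMomentDeficit_of_smallCircle` and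
`systemMomentDeficit_of_discMajorantLog` (p140704), `stub_smallCircle_of_discMajorantLog` (p140287),
`smallCircleJensen_X` (p140780), `smallCircle_of_systemZeroRepulsion` (p140991). -/

/-- **The crux BY NAME** (closes stmt-Parity-11326 modulo the one open registered stub VSG
`stub_verticalSubGaussian`; everything else of the line is in the tree). -/
theorem SystemMomentDeficit_of : SystemMomentDeficit :=
  systemMomentDeficit_of_verticalSubGaussian stub_verticalSubGaussian

end Summit.Parity.BatemanHorn.Cruxes.SystemMomentDeficit.SmallCircle

end
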